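import Summits.QuantumFields.BalabanUV.Beta.CompositeVertexKernelRec

/-!
# `BalabanUV.Beta.CompositeVertexKernelRecTwo` — row D1 ∕ (C1), file F5 in the BRICK-GENERIC shape, part 1: THE m-FOLD COMPOSITE AVERAGING's
# SECOND-ORDER BORDER KERNEL (one fluctuation bond, two background bonds) BY THE TOP-PEELED CHAIN RULE

WHAT.  Over the abstract one-step bricks of `CompositeVertexKernelRec` (`ℓ m` linear, `𝓋 m` mixed first-order) and ONE more brick — the
level-`m` SECOND-ORDER border kernel `𝓋₂ m μ y g g′ g″` (fluctuation bond `g`, background bonds `g′, g″`; an1's `vh2KerAt (toSite (r m)) L` ∕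
`symVh2KerAt`) — the composite second-order border kernel **`compVH2Ker ℓ 𝓋 𝓋₂ L m μ y f b b′`** by the FOUR-SUMMAND top-peeled chain rule
(the lattice face of leaf-02's `TorusCompositeCovarianceTwoPolar.compIns₂₂_succ`, scalars stripped — they sit in the bricks ∕ in F4's units):
`0` at depth `0`; at depth `m+1`
  `Σ 𝓋₂ m μ y g g′ g″ · c f g · c b g′ · c b′ g″`  (top third table, three linear transports `c := compLinKer … m`)
`+ Σ 𝓋 m μ y g g″ · compVHKer … m g f b · c b′ g″ + Σ 𝓋 m μ y g g′ · compVHKer … m g f b′ · c b g′`  (top mixed table, the fluctuation leg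
   carrying the depth-`m` composite's mixed vertex in `(f, b)` resp. `(f, b′)`)
`+ Σ ℓ m μ y g · compVH2Ker … m g f b b′`  (top linear kernel ∘ the depth-`m` composite's own second-order kernel),
all sums over the window bonds `g = (κ, L·y + e)`, `e ∈ offs L`.  LETTERS (this part): unfolding by `rfl`; ANCHOR `compVH2Ker_one` (depth one IS
`𝓋₂ 0`); SUPPORT in each of the three finest bonds by induction (`compVH2Ker_eq_zero_fluct ∕ _left ∕ _right`, window `winF (L^m) (wid L m)`);
BLOCK-TRANSLATION COVARIANCE `compVH2Ker_sh`.  Part 2 (bounds, the packed `LocStencil₂`-type family, the two instantiations) follows F3's part 2.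

[folklore] finite sums ∕ inductions over OUR typed objects; one [our object] bookkeeping definition.  Nothing of Bałaban's asserted, valued or
discharged; 0 estimates; 0∕4 row-D1 binders; NOT (C1), NOT D1, NEVER «G-an2-4 closed», NOT BetaPertH, NOT continuum, NOT Clay.

HONEST DEPENDENCY (page 1, mandatory): continuum YM on T⁴ ⇐ BetaPertH ∧ nine spine estimates (0/9 proved); BetaPertH ⇐ (D1) ∧ (D4) ∧ CAP+tail;
G-an2-4 gates asym, D1 and NE2/3/4.  Row D1 ∕ (C1) OWNER an2, gen 50, 2026-08-23.  No existing file touched.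
-/

noncomputable section

open scoped BigOperators

namespace Summit.QuantumFields.BalabanUV.Beta.CompositeVertexKernelRec

open Finset
open Literature.MathematicalPhysics.QuantumFieldTheory.Balaban1983to89
open Literature.MathematicalPhysics.QuantumFieldTheory.Balaban1983to89.Beta
open AffineAveraging (Site box toSite)
open AveragingHessianKernels (Bond Near packVH)

variable {d : ℕ}

variable (ℓ : ℕ → Fin (d + 1) → Site (d + 1) → Bond (d + 1) → ℝ)
  (𝓋 : ℕ → Fin (d + 1) → Site (d + 1) → Bond (d + 1) → Bond (d + 1) → ℝ)
  (𝓋₂ : ℕ → Fin (d + 1) → Site (d + 1) → Bond (d + 1) → Bond (d + 1) → Bond (d + 1) → ℝ) (L : ℕ)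

/-! ## §1 The composite second-order border kernel -/

/-- [our object — bookkeeping] **THE COMPOSITE SECOND-ORDER BORDER KERNEL, TOP-PEELED** (one fluctuation bond `f`, two background bonds
`b, b′`, multiplier leg at the level-`m` bond `(μ, y)`): the four-summand chain rule of the module docstring. -/
def compVH2Ker : ℕ → Fin (d + 1) → Site (d + 1) → Bond (d + 1) → Bond (d + 1) → Bond (d + 1) → ℝ
  | 0, _, _, _, _, _ => 0
  | m + 1, μ, y, f, b, b' =>
      (∑ κ : Fin (d + 1), ∑ e ∈ offs L, ∑ κ' : Fin (d + 1), ∑ e' ∈ offs L, ∑ κ'' : Fin (d + 1), ∑ e'' ∈ offs L,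
          𝓋₂ m μ y (κ, (L : ℤ) • y + e) (κ', (L : ℤ) • y + e') (κ'', (L : ℤ) • y + e'')
            * compLinKer ℓ L m f (κ, (L : ℤ) • y + e) * compLinKer ℓ L m b (κ', (L : ℤ) • y + e')
            * compLinKer ℓ L m b' (κ'', (L : ℤ) • y + e''))
        + (∑ κ : Fin (d + 1), ∑ e ∈ offs L, ∑ κ'' : Fin (d + 1), ∑ e'' ∈ offs L,
            𝓋 m μ y (κ, (L : ℤ) • y + e) (κ'', (L : ℤ) • y + e'')
              * compVHKer ℓ 𝓋 L m κ ((L : ℤ) • y + e) f b * compLinKer ℓ L m b' (κ'', (L : ℤ) • y + e''))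
        + (∑ κ : Fin (d + 1), ∑ e ∈ offs L, ∑ κ' : Fin (d + 1), ∑ e' ∈ offs L,
            𝓋 m μ y (κ, (L : ℤ) • y + e) (κ', (L : ℤ) • y + e')
              * compVHKer ℓ 𝓋 L m κ ((L : ℤ) • y + e) f b' * compLinKer ℓ L m b (κ', (L : ℤ) • y + e'))
        + ∑ κ : Fin (d + 1), ∑ e ∈ offs L,
            ℓ m μ y (κ, (L : ℤ) • y + e) * compVH2Ker m κ ((L : ℤ) • y + e) f b b'

variable {ℓ 𝓋 𝓋₂ L}

/-- unfolding, depth `0`. -/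
@[simp] theorem compVH2Ker_zero (μ : Fin (d + 1)) (y : Site (d + 1)) (f b b' : Bond (d + 1)) :
    compVH2Ker ℓ 𝓋 𝓋₂ L 0 μ y f b b' = 0 := rfl

/-- unfolding, depth `m+1` (TOP-PEEL by `rfl`). -/
theorem compVH2Ker_succ (m : ℕ) (μ : Fin (d + 1)) (y : Site (d + 1)) (f b b' : Bond (d + 1)) :
    compVH2Ker ℓ 𝓋 𝓋₂ L (m + 1) μ y f b b' =
      (∑ κ : Fin (d + 1), ∑ e ∈ offs L, ∑ κ' : Fin (d + 1), ∑ e' ∈ offs L, ∑ κ'' : Fin (d + 1), ∑ e'' ∈ offs L,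
          𝓋₂ m μ y (κ, (L : ℤ) • y + e) (κ', (L : ℤ) • y + e') (κ'', (L : ℤ) • y + e'')
            * compLinKer ℓ L m f (κ, (L : ℤ) • y + e) * compLinKer ℓ L m b (κ', (L : ℤ) • y + e')
            * compLinKer ℓ L m b' (κ'', (L : ℤ) • y + e''))
        + (∑ κ : Fin (d + 1), ∑ e ∈ offs L, ∑ κ'' : Fin (d + 1), ∑ e'' ∈ offs L,
            𝓋 m μ y (κ, (L : ℤ) • y + e) (κ'', (L : ℤ) • y + e'')
              * compVHKer ℓ 𝓋 L m κ ((L : ℤ) • y + e) f b * compLinKer ℓ L m b' (κ'', (L : ℤ) • y + e''))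
        + (∑ κ : Fin (d + 1), ∑ e ∈ offs L, ∑ κ' : Fin (d + 1), ∑ e' ∈ offs L,
            𝓋 m μ y (κ, (L : ℤ) • y + e) (κ', (L : ℤ) • y + e')
              * compVHKer ℓ 𝓋 L m κ ((L : ℤ) • y + e) f b' * compLinKer ℓ L m b (κ', (L : ℤ) • y + e'))
        + ∑ κ : Fin (d + 1), ∑ e ∈ offs L,
            ℓ m μ y (κ, (L : ℤ) • y + e) * compVH2Ker ℓ 𝓋 𝓋₂ L m κ ((L : ℤ) • y + e) f b b' := rfl

/-! ## §2 Anchor: depth one IS the level-`0` second-order brick -/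

/-- [folklore] The triple window sum against three depth-`0` indicators picks the brick's own value. -/
theorem sum_window3_mul_indicator {L : ℕ} (F : Bond (d + 1) → Bond (d + 1) → Bond (d + 1) → ℝ) (y : Site (d + 1))
    (f b b' : Bond (d + 1)) (hF1 : ∀ g' g'', ¬ Near L y f.2 → F f g' g'' = 0) (hF2 : ∀ g g'', ¬ Near L y b.2 → F g b g'' = 0)
    (hF3 : ∀ g g', ¬ Near L y b'.2 → F g g' b' = 0) :
    (∑ κ : Fin (d + 1), ∑ e ∈ offs L, ∑ κ' : Fin (d + 1), ∑ e' ∈ offs L, ∑ κ'' : Fin (d + 1), ∑ e'' ∈ offs L,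
        F (κ, (L : ℤ) • y + e) (κ', (L : ℤ) • y + e') (κ'', (L : ℤ) • y + e'')
          * (if ((κ, (L : ℤ) • y + e) : Bond (d + 1)) = f then (1 : ℝ) else 0)
          * (if ((κ', (L : ℤ) • y + e') : Bond (d + 1)) = b then (1 : ℝ) else 0)
          * (if ((κ'', (L : ℤ) • y + e'') : Bond (d + 1)) = b' then (1 : ℝ) else 0))
      = F f b b' := by
  -- innermost pair (κ'', e'') first, then (κ', e'), then (κ, e)
  have h3 : ∀ g g' : Bond (d + 1),
      (∑ κ'' : Fin (d + 1), ∑ e'' ∈ offs L,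
          F g g' (κ'', (L : ℤ) • y + e'') * (if g = f then (1 : ℝ) else 0) * (if g' = b then (1 : ℝ) else 0)
            * (if ((κ'', (L : ℤ) • y + e'') : Bond (d + 1)) = b' then (1 : ℝ) else 0))
        = (if g = f then (1 : ℝ) else 0) * (if g' = b then (1 : ℝ) else 0) * F g g' b' := by
    intro g g'
    have h := sum_window_mul_indicator (L := L) (fun c => F g g' c) y b' (hF3 g g')
    calc _ = (if g = f then (1 : ℝ) else 0) * (if g' = b then (1 : ℝ) else 0)
              * ∑ κ'' : Fin (d + 1), ∑ e'' ∈ offs L,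
                  F g g' (κ'', (L : ℤ) • y + e'') * (if ((κ'', (L : ℤ) • y + e'') : Bond (d + 1)) = b' then (1 : ℝ) else 0) := by
            rw [Finset.mul_sum]
            refine Finset.sum_congr rfl fun κ'' _ => ?_
            rw [Finset.mul_sum]
            exact Finset.sum_congr rfl fun e'' _ => by ring
      _ = _ := by rw [h]
  simp_rw [h3]
  have h2 : ∀ g : Bond (d + 1),
      (∑ κ' : Fin (d + 1), ∑ e' ∈ offs L,
          (if g = f then (1 : ℝ) else 0) * (if ((κ', (L : ℤ) • y + e') : Bond (d + 1)) = b then (1 : ℝ) else 0)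
            * F g (κ', (L : ℤ) • y + e') b')
        = (if g = f then (1 : ℝ) else 0) * F g b b' := by
    intro g
    have h := sum_window_mul_indicator (L := L) (fun c => F g c b') y b (fun hn => hF2 g b' hn)
    calc _ = (if g = f then (1 : ℝ) else 0)
              * ∑ κ' : Fin (d + 1), ∑ e' ∈ offs L,
                  F g (κ', (L : ℤ) • y + e') b' * (if ((κ', (L : ℤ) • y + e') : Bond (d + 1)) = b then (1 : ℝ) else 0) := by
            rw [Finset.mul_sum]
            refine Finset.sum_congr rfl fun κ' _ => ?_
            rw [Finset.mul_sum]
            exact Finset.sum_congr rfl fun e' _ => by ring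
      _ = _ := by rw [h]
  simp_rw [h2]
  have h1 := sum_window_mul_indicator (L := L) (fun c => F c b b') y f (fun hn => hF1 b b' hn)
  rw [← h1]
  exact Finset.sum_congr rfl fun κ _ => Finset.sum_congr rfl fun e _ => mul_comm _ _

/-- [folklore] ANCHOR: the depth-one composite second-order border kernel IS the level-`0` brick. -/
theorem compVH2Ker_one (h₁ : ∀ m μ y g g' g'', ¬ Near L y g.2 → 𝓋₂ m μ y g g' g'' = 0)
    (h₂ : ∀ m μ y g g' g'', ¬ Near L y g'.2 → 𝓋₂ m μ y g g' g'' = 0) (h₃ : ∀ m μ y g g' g'', ¬ Near L y g''.2 → 𝓋₂ m μ y g g' g'' = 0)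
    (μ : Fin (d + 1)) (y : Site (d + 1)) (f b b' : Bond (d + 1)) :
    compVH2Ker ℓ 𝓋 𝓋₂ L 1 μ y f b b' = 𝓋₂ 0 μ y f b b' := by
  rw [compVH2Ker_succ]
  simp only [compVH2Ker_zero, compVHKer_zero, compLinKer_zero, mul_zero, zero_mul, Finset.sum_const_zero, add_zero]
  exact sum_window3_mul_indicator (fun g g' g'' => 𝓋₂ 0 μ y g g' g'') y f b b' (fun g' g'' h => h₁ 0 μ y f g' g'' h)
    (fun g g'' h => h₂ 0 μ y g b g'' h) (fun g g' h => h₃ 0 μ y g g' b' h)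

/-! ## §3 Support by induction -/

/-- [folklore] SUPPORT IN THE FLUCTUATION BOND. -/
theorem compVH2Ker_eq_zero_fluct : ∀ (m : ℕ) {μ : Fin (d + 1)} {y : Site (d + 1)} {f : Bond (d + 1)} (b b' : Bond (d + 1)),
    f.2 ∉ winF (L ^ m) (wid L m) y → compVH2Ker ℓ 𝓋 𝓋₂ L m μ y f b b' = 0
  | 0, _, _, _, _, _, _ => rfl
  | m + 1, μ, y, f, b, b', h => by
      rw [compVH2Ker_succ]
      have A : ∀ κ, ∀ e ∈ offs L, compLinKer ℓ L m f (κ, (L : ℤ) • y + e) = 0 :=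
        fun κ e he => compLinKer_eq_zero m fun hn => h (mem_winF_succ_of_offs he hn)
      have B : ∀ κ, ∀ e ∈ offs L, ∀ c : Bond (d + 1), compVHKer ℓ 𝓋 L m κ ((L : ℤ) • y + e) f c = 0 :=
        fun κ e he c => compVHKer_eq_zero_left m c fun hn => h (mem_winF_succ_of_offs he hn)
      have C : ∀ κ, ∀ e ∈ offs L, compVH2Ker ℓ 𝓋 𝓋₂ L m κ ((L : ℤ) • y + e) f b b' = 0 :=
        fun κ e he => compVH2Ker_eq_zero_fluct m b b' fun hn => h (mem_winF_succ_of_offs he hn)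
      have S1 : (∑ κ : Fin (d + 1), ∑ e ∈ offs L, ∑ κ' : Fin (d + 1), ∑ e' ∈ offs L, ∑ κ'' : Fin (d + 1), ∑ e'' ∈ offs L,
          𝓋₂ m μ y (κ, (L : ℤ) • y + e) (κ', (L : ℤ) • y + e') (κ'', (L : ℤ) • y + e'')
            * compLinKer ℓ L m f (κ, (L : ℤ) • y + e) * compLinKer ℓ L m b (κ', (L : ℤ) • y + e')
            * compLinKer ℓ L m b' (κ'', (L : ℤ) • y + e'')) = 0 :=
        Finset.sum_eq_zero fun κ _ => Finset.sum_eq_zero fun e he => Finset.sum_eq_zero fun κ' _ =>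
          Finset.sum_eq_zero fun e' _ => Finset.sum_eq_zero fun κ'' _ => Finset.sum_eq_zero fun e'' _ => by
            rw [A κ e he, mul_zero, zero_mul, zero_mul]
      have S2 : (∑ κ : Fin (d + 1), ∑ e ∈ offs L, ∑ κ'' : Fin (d + 1), ∑ e'' ∈ offs L,
          𝓋 m μ y (κ, (L : ℤ) • y + e) (κ'', (L : ℤ) • y + e'')
            * compVHKer ℓ 𝓋 L m κ ((L : ℤ) • y + e) f b * compLinKer ℓ L m b' (κ'', (L : ℤ) • y + e'')) = 0 :=
        Finset.sum_eq_zero fun κ _ => Finset.sum_eq_zero fun e he => Finset.sum_eq_zero fun κ'' _ =>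
          Finset.sum_eq_zero fun e'' _ => by rw [B κ e he b, mul_zero, zero_mul]
      have S3 : (∑ κ : Fin (d + 1), ∑ e ∈ offs L, ∑ κ' : Fin (d + 1), ∑ e' ∈ offs L,
          𝓋 m μ y (κ, (L : ℤ) • y + e) (κ', (L : ℤ) • y + e')
            * compVHKer ℓ 𝓋 L m κ ((L : ℤ) • y + e) f b' * compLinKer ℓ L m b (κ', (L : ℤ) • y + e')) = 0 :=
        Finset.sum_eq_zero fun κ _ => Finset.sum_eq_zero fun e he => Finset.sum_eq_zero fun κ' _ =>
          Finset.sum_eq_zero fun e' _ => by rw [B κ e he b', mul_zero, zero_mul]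
      have S4 : (∑ κ : Fin (d + 1), ∑ e ∈ offs L,
          ℓ m μ y (κ, (L : ℤ) • y + e) * compVH2Ker ℓ 𝓋 𝓋₂ L m κ ((L : ℤ) • y + e) f b b') = 0 :=
        Finset.sum_eq_zero fun κ _ => Finset.sum_eq_zero fun e he => by rw [C κ e he, mul_zero]
      rw [S1, S2, S3, S4]; ring

/-- [folklore] SUPPORT IN THE FIRST BACKGROUND BOND. -/
theorem compVH2Ker_eq_zero_left : ∀ (m : ℕ) {μ : Fin (d + 1)} {y : Site (d + 1)} (f : Bond (d + 1)) {b : Bond (d + 1)} (b' : Bond (d + 1)),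
    b.2 ∉ winF (L ^ m) (wid L m) y → compVH2Ker ℓ 𝓋 𝓋₂ L m μ y f b b' = 0
  | 0, _, _, _, _, _, _ => rfl
  | m + 1, μ, y, f, b, b', h => by
      rw [compVH2Ker_succ]
      have A : ∀ κ, ∀ e ∈ offs L, compLinKer ℓ L m b (κ, (L : ℤ) • y + e) = 0 :=
        fun κ e he => compLinKer_eq_zero m fun hn => h (mem_winF_succ_of_offs he hn)
      have B : ∀ κ, ∀ e ∈ offs L, compVHKer ℓ 𝓋 L m κ ((L : ℤ) • y + e) f b = 0 :=
        fun κ e he => compVHKer_eq_zero_right m f fun hn => h (mem_winF_succ_of_offs he hn)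
      have C : ∀ κ, ∀ e ∈ offs L, compVH2Ker ℓ 𝓋 𝓋₂ L m κ ((L : ℤ) • y + e) f b b' = 0 :=
        fun κ e he => compVH2Ker_eq_zero_left m f b' fun hn => h (mem_winF_succ_of_offs he hn)
      have S1 : (∑ κ : Fin (d + 1), ∑ e ∈ offs L, ∑ κ' : Fin (d + 1), ∑ e' ∈ offs L, ∑ κ'' : Fin (d + 1), ∑ e'' ∈ offs L,
          𝓋₂ m μ y (κ, (L : ℤ) • y + e) (κ', (L : ℤ) • y + e') (κ'', (L : ℤ) • y + e'')
            * compLinKer ℓ L m f (κ, (L : ℤ) • y + e) * compLinKer ℓ L m b (κ', (L : ℤ) • y + e')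
            * compLinKer ℓ L m b' (κ'', (L : ℤ) • y + e'')) = 0 :=
        Finset.sum_eq_zero fun κ _ => Finset.sum_eq_zero fun e _ => Finset.sum_eq_zero fun κ' _ =>
          Finset.sum_eq_zero fun e' he' => Finset.sum_eq_zero fun κ'' _ => Finset.sum_eq_zero fun e'' _ => by
            rw [A κ' e' he', mul_zero, zero_mul]
      have S2 : (∑ κ : Fin (d + 1), ∑ e ∈ offs L, ∑ κ'' : Fin (d + 1), ∑ e'' ∈ offs L,
          𝓋 m μ y (κ, (L : ℤ) • y + e) (κ'', (L : ℤ) • y + e'')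
            * compVHKer ℓ 𝓋 L m κ ((L : ℤ) • y + e) f b * compLinKer ℓ L m b' (κ'', (L : ℤ) • y + e'')) = 0 :=
        Finset.sum_eq_zero fun κ _ => Finset.sum_eq_zero fun e he => Finset.sum_eq_zero fun κ'' _ =>
          Finset.sum_eq_zero fun e'' _ => by rw [B κ e he, mul_zero, zero_mul]
      have S3 : (∑ κ : Fin (d + 1), ∑ e ∈ offs L, ∑ κ' : Fin (d + 1), ∑ e' ∈ offs L,
          𝓋 m μ y (κ, (L : ℤ) • y + e) (κ', (L : ℤ) • y + e')
            * compVHKer ℓ 𝓋 L m κ ((L : ℤ) • y + e) f b' * compLinKer ℓ L m b (κ', (L : ℤ) • y + e')) = 0 :=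
        Finset.sum_eq_zero fun κ _ => Finset.sum_eq_zero fun e _ => Finset.sum_eq_zero fun κ' _ =>
          Finset.sum_eq_zero fun e' he' => by rw [A κ' e' he', mul_zero]
      have S4 : (∑ κ : Fin (d + 1), ∑ e ∈ offs L,
          ℓ m μ y (κ, (L : ℤ) • y + e) * compVH2Ker ℓ 𝓋 𝓋₂ L m κ ((L : ℤ) • y + e) f b b') = 0 :=
        Finset.sum_eq_zero fun κ _ => Finset.sum_eq_zero fun e he => by rw [C κ e he, mul_zero]
      rw [S1, S2, S3, S4]; ring

/-- [folklore] SUPPORT IN THE SECOND BACKGROUND BOND. -/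
theorem compVH2Ker_eq_zero_right : ∀ (m : ℕ) {μ : Fin (d + 1)} {y : Site (d + 1)} (f b : Bond (d + 1)) {b' : Bond (d + 1)},
    b'.2 ∉ winF (L ^ m) (wid L m) y → compVH2Ker ℓ 𝓋 𝓋₂ L m μ y f b b' = 0
  | 0, _, _, _, _, _, _ => rfl
  | m + 1, μ, y, f, b, b', h => by
      rw [compVH2Ker_succ]
      have A : ∀ κ, ∀ e ∈ offs L, compLinKer ℓ L m b' (κ, (L : ℤ) • y + e) = 0 :=
        fun κ e he => compLinKer_eq_zero m fun hn => h (mem_winF_succ_of_offs he hn)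
      have B : ∀ κ, ∀ e ∈ offs L, compVHKer ℓ 𝓋 L m κ ((L : ℤ) • y + e) f b' = 0 :=
        fun κ e he => compVHKer_eq_zero_right m f fun hn => h (mem_winF_succ_of_offs he hn)
      have C : ∀ κ, ∀ e ∈ offs L, compVH2Ker ℓ 𝓋 𝓋₂ L m κ ((L : ℤ) • y + e) f b b' = 0 :=
        fun κ e he => compVH2Ker_eq_zero_right m f b fun hn => h (mem_winF_succ_of_offs he hn)
      have S1 : (∑ κ : Fin (d + 1), ∑ e ∈ offs L, ∑ κ' : Fin (d + 1), ∑ e' ∈ offs L, ∑ κ'' : Fin (d + 1), ∑ e'' ∈ offs L,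
          𝓋₂ m μ y (κ, (L : ℤ) • y + e) (κ', (L : ℤ) • y + e') (κ'', (L : ℤ) • y + e'')
            * compLinKer ℓ L m f (κ, (L : ℤ) • y + e) * compLinKer ℓ L m b (κ', (L : ℤ) • y + e')
            * compLinKer ℓ L m b' (κ'', (L : ℤ) • y + e'')) = 0 :=
        Finset.sum_eq_zero fun κ _ => Finset.sum_eq_zero fun e _ => Finset.sum_eq_zero fun κ' _ =>
          Finset.sum_eq_zero fun e' _ => Finset.sum_eq_zero fun κ'' _ => Finset.sum_eq_zero fun e'' he'' => by
            rw [A κ'' e'' he'', mul_zero]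
      have S2 : (∑ κ : Fin (d + 1), ∑ e ∈ offs L, ∑ κ'' : Fin (d + 1), ∑ e'' ∈ offs L,
          𝓋 m μ y (κ, (L : ℤ) • y + e) (κ'', (L : ℤ) • y + e'')
            * compVHKer ℓ 𝓋 L m κ ((L : ℤ) • y + e) f b * compLinKer ℓ L m b' (κ'', (L : ℤ) • y + e'')) = 0 :=
        Finset.sum_eq_zero fun κ _ => Finset.sum_eq_zero fun e _ => Finset.sum_eq_zero fun κ'' _ =>
          Finset.sum_eq_zero fun e'' he'' => by rw [A κ'' e'' he'', mul_zero]
      have S3 : (∑ κ : Fin (d + 1), ∑ e ∈ offs L, ∑ κ' : Fin (d + 1), ∑ e' ∈ offs L,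
          𝓋 m μ y (κ, (L : ℤ) • y + e) (κ', (L : ℤ) • y + e')
            * compVHKer ℓ 𝓋 L m κ ((L : ℤ) • y + e) f b' * compLinKer ℓ L m b (κ', (L : ℤ) • y + e')) = 0 :=
        Finset.sum_eq_zero fun κ _ => Finset.sum_eq_zero fun e he => Finset.sum_eq_zero fun κ' _ =>
          Finset.sum_eq_zero fun e' _ => by rw [B κ e he, mul_zero, zero_mul]
      have S4 : (∑ κ : Fin (d + 1), ∑ e ∈ offs L,
          ℓ m μ y (κ, (L : ℤ) • y + e) * compVH2Ker ℓ 𝓋 𝓋₂ L m κ ((L : ℤ) • y + e) f b b') = 0 :=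
        Finset.sum_eq_zero fun κ _ => Finset.sum_eq_zero fun e he => by rw [C κ e he, mul_zero]
      rw [S1, S2, S3, S4]; ring

/-! ## §4 Block-translation covariance -/

/-- [folklore] COVARIANCE OF THE COMPOSITE SECOND-ORDER BORDER KERNEL under block translations. -/
theorem compVH2Ker_sh (hℓsh : ∀ m μ y t f, ℓ m μ (y + t) (f.sh ((L : ℤ) • t)) = ℓ m μ y f)
    (h𝓋sh : ∀ m μ y t f f', 𝓋 m μ (y + t) (f.sh ((L : ℤ) • t)) (f'.sh ((L : ℤ) • t)) = 𝓋 m μ y f f')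
    (h𝓋₂sh : ∀ m μ y t g g' g'', 𝓋₂ m μ (y + t) (g.sh ((L : ℤ) • t)) (g'.sh ((L : ℤ) • t)) (g''.sh ((L : ℤ) • t)) = 𝓋₂ m μ y g g' g'')
    (m : ℕ) (f b b' : Bond (d + 1)) :
    ∀ (μ : Fin (d + 1)) (y t : Site (d + 1)),
      compVH2Ker ℓ 𝓋 𝓋₂ L m μ (y + t) (f.sh ((L : ℤ) ^ m • t)) (b.sh ((L : ℤ) ^ m • t)) (b'.sh ((L : ℤ) ^ m • t))
        = compVH2Ker ℓ 𝓋 𝓋₂ L m μ y f b b' := by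
  induction m with
  | zero => intro μ y t; rw [compVH2Ker_zero, compVH2Ker_zero]
  | succ m ih =>
      intro μ y t
      rw [compVH2Ker_succ, compVH2Ker_succ]
      have e3 : (L : ℤ) ^ (m + 1) • t = (L : ℤ) ^ m • ((L : ℤ) • t) := by rw [pow_succ, mul_smul]
      have e4 : ∀ e : Site (d + 1), (L : ℤ) • (y + t) + e = ((L : ℤ) • y + e) + (L : ℤ) • t := fun e => by
        rw [smul_add]; abel
      have T1 : ∀ κ κ' κ'' (e e' e'' : Site (d + 1)),
          𝓋₂ m μ (y + t) (κ, (L : ℤ) • (y + t) + e) (κ', (L : ℤ) • (y + t) + e') (κ'', (L : ℤ) • (y + t) + e'')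
            * compLinKer ℓ L m (f.sh ((L : ℤ) ^ (m + 1) • t)) (κ, (L : ℤ) • (y + t) + e)
            * compLinKer ℓ L m (b.sh ((L : ℤ) ^ (m + 1) • t)) (κ', (L : ℤ) • (y + t) + e')
            * compLinKer ℓ L m (b'.sh ((L : ℤ) ^ (m + 1) • t)) (κ'', (L : ℤ) • (y + t) + e'')
          = 𝓋₂ m μ y (κ, (L : ℤ) • y + e) (κ', (L : ℤ) • y + e') (κ'', (L : ℤ) • y + e'')
            * compLinKer ℓ L m f (κ, (L : ℤ) • y + e) * compLinKer ℓ L m b (κ', (L : ℤ) • y + e')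
            * compLinKer ℓ L m b' (κ'', (L : ℤ) • y + e'') := by
        intro κ κ' κ'' e e' e''
        rw [window_bond_sh L κ, window_bond_sh L κ', window_bond_sh L κ'', h𝓋₂sh, e3, compLinKer_sh hℓsh, compLinKer_sh hℓsh,
          compLinKer_sh hℓsh]
      have T2 : ∀ κ κ'' (e e'' : Site (d + 1)) (c c' : Bond (d + 1)),
          𝓋 m μ (y + t) (κ, (L : ℤ) • (y + t) + e) (κ'', (L : ℤ) • (y + t) + e'')
            * compVHKer ℓ 𝓋 L m κ ((L : ℤ) • (y + t) + e) (f.sh ((L : ℤ) ^ (m + 1) • t)) (c.sh ((L : ℤ) ^ (m + 1) • t))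
            * compLinKer ℓ L m (c'.sh ((L : ℤ) ^ (m + 1) • t)) (κ'', (L : ℤ) • (y + t) + e'')
          = 𝓋 m μ y (κ, (L : ℤ) • y + e) (κ'', (L : ℤ) • y + e'')
            * compVHKer ℓ 𝓋 L m κ ((L : ℤ) • y + e) f c * compLinKer ℓ L m c' (κ'', (L : ℤ) • y + e'') := by
        intro κ κ'' e e'' c c'
        rw [window_bond_sh L κ, window_bond_sh L κ'', h𝓋sh, e3, compLinKer_sh hℓsh, e4 e, compVHKer_sh hℓsh h𝓋sh]
      have T4 : ∀ κ (e : Site (d + 1)),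
          ℓ m μ (y + t) (κ, (L : ℤ) • (y + t) + e)
            * compVH2Ker ℓ 𝓋 𝓋₂ L m κ ((L : ℤ) • (y + t) + e) (f.sh ((L : ℤ) ^ (m + 1) • t)) (b.sh ((L : ℤ) ^ (m + 1) • t))
                (b'.sh ((L : ℤ) ^ (m + 1) • t))
          = ℓ m μ y (κ, (L : ℤ) • y + e) * compVH2Ker ℓ 𝓋 𝓋₂ L m κ ((L : ℤ) • y + e) f b b' := by
        intro κ e
        rw [window_bond_sh, hℓsh, e3, e4 e, ih κ ((L : ℤ) • y + e) ((L : ℤ) • t)]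
      simp_rw [T1, T2, T4]

end Summit.QuantumFields.BalabanUV.Beta.CompositeVertexKernelRec

end
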